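import Summits.QuantumFields.BalabanUV.Beta.D1BFx.RoadEndBFxRoadScalesJ1RFlatS
import Summits.QuantumFields.BalabanUV.Beta.D1BFx.RoadCombPinAn1

/-!
# `BalabanUV.Beta.D1BFx.RoadEndBFxCombS` — road «BF-x», row D1: **PART 23-comb «THE RE-TABLED PIN»** (an2 RULING R-D1-g55-1 (2), RE-TABLE FINAL:
# «road BF-x keeps its comb slice `G₀ = coDressKBmAt ρ_c n (KInvStep n 0)` and carries the COMB SCHEME's WHOLE table record at `n = Lc^m` … the road's (J1) pin
# reads `Vc, Wc` := the raw level-0 families over that record … as `combTablesAn1S2 (Lc^m) hLc.pow (cΛ m)` through the existing level-0 packaging»;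
# `HOME/b2b-balaban-beta-d1-p2/RETABLE-SPEC-g28.md` §2).  PART 22's head (`RoadEndBFxRoadScalesJ1RowS` over PART 21♭ `RoadEndBFxRoadScalesJ1RFlatS`: the spine's
# `D1Rep` with (J1) as ONE ROW) AT THE RE-TABLED ROAD: the block root PINNED to the centre (`hrpin : r n = ctrOff 4 n`), the first-derivative family PINNED
# (`hSpin`) to the odd-indexed RAW member of the chart-(III′) family over the COMB record `CombTablesAn1.combTablesAn1S2` with the locks read through `Nat.log Lc`,
# its seven [S] sockets DISCHARGED inside (`RoadCombPinAn1.S_locStencil ∕ Cs_nonneg ∕ δ_pos ∕ S_covB ∕ S_inr_inr ∕ S_inl_inr ∕ S_inl_inl`), everything else —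
# the pair family `S₂` (the caller's; at the record `S₂ (Lc^m) := (Lc^m)⁸ • wilsonW₂ 3 ((8N²)⁻¹ • wsym22 N) + cB m • vh₂SAn1 (Lc^m)`) and its sockets, the [M] block in
# PART 21♭'s flat currency, the torus pins, [W] = [P1′]∕[P2′], (J2) + `RJ2`, (C1)(C2)(C3), the GAP ROW, and (J1) = THE ONE ROW `hC₁` (now the RE-TABLED chart
# defect `Δ_ret,n = TshotOf Lc Jc m − hessKer (G₀^{bm}(ctrOff)) (vertexOfK … (S (Lc^m))) (vertex2OfK … (S₂ (Lc^m)))` between the literal of record `Jc` and the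
# road's kernel at the COMB tables; OPEN — its by-value viability is condition (B) of R-D1-g55-1) — DISPLAYED VERBATIM as in PART 23.  The hybrid pin PART 23
# (`RoadEndBFxHybS`) STANDS ((J1-β) pricing closed by value, R-D1-g54-1 (1)(a)); this file is its comb twin, not a replacement.  Proof = PART 23's, over PART 21♭.

HONEST DEPENDENCY (cell records, verbatim): «continuum YM on T⁴ ⇐ BetaPertH ∧ nine spine estimates (0/9 proved); BetaPertH ⇐ (D1) ∧ (D4) ∧
CAP+tail; G-an2-4 gates asym, D1 and NE2/3/4.»  HONEST FRAMING (cell contract, verbatim): «discharging `BetaPertH` makes Bałaban's UV stability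
UNCONDITIONAL — a real constructive-QFT result; it is NOT the continuum limit and NOT the Clay problem.»  THIS MODULE DISCHARGES NOTHING of (K), of
D1 or of the wall: [folklore] instantiation BY NAME; (J1) is an OPEN ROW (`hC₁`), not an identity and not an estimate proved here.  No definition, no
`def … : Prop`, nothing cited, 0 sorry.  0∕4 row-D1 binders (hW ∕ hR ∕ D1Tel ∕ D1Rep) discharged; (K) NOT closed; NOT D1, NEVER «G-an2-4 closed», NOT `BetaPertH`,
NOT continuum, NOT Clay.

ABSOLUTE RULE (cell charter, verbatim): «No internally-minted statement may enter as a cited fact. Every hypothesis is either kernel-proved in this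
package or a verbatim quotation of a PUBLISHED theorem with page reference. The manuscript(s) under audit are NOT citable for their own disputed
steps — they are the thing under adjudication; programme-internal (2001/route/tribunal) claims are never citable.»

CONTENT (all [folklore]): **`d1Rep_BFx_comb_sbpS`**.  Unit `b2b-balaban-beta-d1-p2` (road owner, gen 28), 2026-08-25; generator `g28/gen/mk_end_comb.py` over PART 23's tree bytes; no existing file touched.
-/

noncomputable section
open Finset Filter Topology Matrix
open scoped BigOperators Kronecker
open Literature.MathematicalPhysics.QuantumFieldTheory.Balaban1983to89
open Literature.MathematicalPhysics.QuantumFieldTheory.Balaban1983to89.Beta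
open OneStepResolventKernel (JetData KInv Fib wsum LocStencil)
open OneStepKernelFamily (TbalOf TshotOf flipK D1Tel D1Rep KInvStep colH vertexOfK)
open PolarizationSign (WardTransversal AxisReflectionCovariant)
open InterLevelTransport (onLat)
open BalabanStepJets (lamCoeffOf)
open AveragingHessianKernels (hessFF)
open KernelWard (divV)
open B12Sec2to5 (l1)
open DyadicShell (supNorm)
open ExpKernelCalculus (Site MKer BiLoc shiftK comp hessKer tadpole bubble)
open DecimatedMomentSummable (AbsMoment₂)
open Summit.QuantumFields.BalabanUV.Beta.TameKernelCalculus (Loc trK)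
open Summit.QuantumFields.BalabanUV.Beta.D1BFx.ReducedKernel (TableR TOfRed)
open Summit.QuantumFields.BalabanUV.Beta.D1BFx.DressedTadpoleTable (tableRed)
open Summit.QuantumFields.BalabanUV.Beta.D1BFx.ReducedKernelSandwich (fineHess)
open Summit.QuantumFields.BalabanUV.Beta.D1BFx.FineStencilBF (ffOf)
open Summit.QuantumFields.BalabanUV.Beta.D1BFx.FineStencilBFBalaban (SbfBal)
open Summit.QuantumFields.BalabanUV.Beta.D1BFx.SecondStencilBF (Wbf)
open Summit.QuantumFields.BalabanUV.Beta.D1BFx.GhostKernelComplete (PghQ absMoment₂_PghQ)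
open Summit.QuantumFields.BalabanUV.Beta.D1BFx.GluonLeg (Ga)
open Summit.QuantumFields.BalabanUV.Beta.D1BFx.FrozenLegTails (nOf MOf hn1)
open VectorTailsLoc (fam kfam)
open Literature.MathematicalPhysics.QuantumFieldTheory.Balaban1983to89.Beta.Composition (kkt)
open Summit.QuantumFields.BalabanUV.Beta.AxialDressingRooted (coDressKBmAt coProjBmAtK)
open Summit.QuantumFields.BalabanUV.Beta.D1BFx.SortedKernels (fTL fBL)
open Summit.QuantumFields.BalabanUV.Beta.D1BFx.PackedNSideDictionary (SN)
open Summit.QuantumFields.BalabanUV.Beta.D1BFx.PackedNSidePair (W2NInf)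
open AffineAveraging (box toSite)
open SecondOrderResponse (vertex2OfK)
open Summit.QuantumFields.BalabanUV.Beta.D1BFx.FibredPeriodisation (periodiseF)
open Summit.QuantumFields.BalabanUV.Beta.D1BFx.SortedPack (sortK)
open Summit.QuantumFields.BalabanUV.Beta.D1BFx.SortedReblocking (torusBlockEquiv)
open Summit.QuantumFields.BalabanUV.Beta.D1BFx.SortedEmbedding (e₁)
open Summit.QuantumFields.BalabanUV.Beta.D1BFx.PeriodicArrays (arr)
open Summit.QuantumFields.BalabanUV.Beta.D1BFx.TorusCombKKT (I J CombRows Khat Qhat)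
open Summit.QuantumFields.BalabanUV.Beta.D1BFx.TorusGaugeBasis (What0)
open Summit.QuantumFields.BalabanUV.Beta.D1BFx.TorusGaugeBasisMatrix (Nhat)
open Summit.QuantumFields.BalabanUV.Beta.D1BFx.TorusCoframeJets (Djet)
open Summit.QuantumFields.BalabanUV.Beta.D1BFx.GhostStencil (ghCur)
open Summit.QuantumFields.BalabanUV.Beta.D1BFx.TorusGhostPairStencils (gh₂)
open Summit.QuantumFields.BalabanUV.Beta.D1BFx.WardJetsFromNoether (oslot)
open Summit.QuantumFields.BalabanUV.Beta.D1BFx.ColourLiftAdE3 (c₃)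
open Summit.QuantumFields.BalabanUV.Beta.D1BFx.PackedKernelSplit (blk ffW)
open Summit.QuantumFields.BalabanUV.Beta.D1BFx.ReducedKernelF (TOfLeg)
open Summit.QuantumFields.BalabanUV.Beta.D1BFx.GhostLeg (Ggh)
open Summit.QuantumFields.BalabanUV.Beta.D1BFx.RoadEndBFxJunctionsS (d1Rep_BFx_of_junctions_sbpS)
open Summit.QuantumFields.BalabanUV.Beta.D1BFx.PackedRoadRestFamily (RoadIdx RkRoad Vgh Wgh wroad_eq_dite sum_RkRoad_of_neZero)
open Summit.QuantumFields.BalabanUV.Beta.D1BFx.PackedRoadRowsMass (road_sand_rows_mass road_blk_rows_mass)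
open Summit.QuantumFields.BalabanUV.Beta.D1BFx.CoframeJetMassScales (exists_C1_letters)
open B5Hk163Strip (kappa163_pos kappa163)
open Summit.QuantumFields.BalabanUV.Beta.D1BFx.RestKernelGhostRoad (decay510_ghostWordK_road KG_road_nonneg kappaG_road_pos)
open Summit.QuantumFields.BalabanUV.Beta.D1BFx.RestKernelFPSlotRoad (END_rows_RkFP_road)
open Summit.QuantumFields.BalabanUV.Beta.D1BFx.RestKernelGhostSlotJ (END_rows_RkGhJ)
open Summit.QuantumFields.BalabanUV.Beta.D1BFx.RestKernelSlotGlue (hMR_elim hRu_elim_zero)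
open Summit.QuantumFields.BalabanUV.Beta.D1BFx.GhostStencilRooted (qAntiAt)
open Summit.QuantumFields.BalabanUV.Beta.D1BFx.GhostStencilRootedReflection (ctrHalf)
open Summit.QuantumFields.BalabanUV.Beta.D1BFx.GhostAveragingSquare (qSqAt)
open Summit.QuantumFields.BalabanUV.Beta.D1BFx.GhostDeficitFormula (J3_closed_form)
open Summit.QuantumFields.BalabanUV.Beta.D1BFx.RoadEndBFxRoadScalesJ3S (absMoment₂_lin abs_secondMoment_lin_le)
open Summit.QuantumFields.BalabanUV.Beta.D1BFx.CoframeTableMassScales (exists_C2_letters)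
open Summit.QuantumFields.BalabanUV.Beta.D1BFx.GhostQWordsScales (exists_C3_rows)
open Summit.QuantumFields.BalabanUV.Beta.D1BFx.RoadEndBFxJunctionsRS (d1Rep_BFx_of_junctions_rest_sbpS)
open Summit.QuantumFields.BalabanUV.Beta.D1BFx.RoadEndBFxRoadScalesJ1RFlatS (d1Rep_BFx_road_scales_J1rest_flat_sbpS)
open Summit.QuantumFields.BalabanUV.Beta.CombTablesAn1 (combTablesAn1S2)
open Summit.QuantumFields.BalabanUV.Beta.CombChartStepJets (JsB12CombSh0)
open AveragingContoursRooted (ctrOff ctrOff_mem_box)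
open Summit.QuantumFields.BalabanUV.Beta.D1BFx.RoadOneShotWitness (absMoment₂_road_kernel)
open OneStepKernelFamily (absMoment₂_TshotOf)
open Summit.QuantumFields.BalabanUV.Beta.D1BFx.RoadEndBFxDictPointwiseS (two_le_pow_scale)
open Literature.MathematicalPhysics.QuantumFieldTheory.Balaban1983to89.Beta.StepDriftWitness (absMoment₂_sub_gen)

namespace Summit.QuantumFields.BalabanUV.Beta.D1BFx.RoadEndBFxCombS

variable {Lc : ℕ} [NeZero Lc] {a N cgh₀ : ℝ} {μ ν : Fin 4}
  {cE cVH cΛ cR cK cQ cE₂ cJ4 cΛ₂ cR₂ cQ₂ x₀ ωgl ωgh cgh : ℕ → ℝ} {WE WJ WΛ WR WQ : ℕ → TableR} {CE CJ CΛt CRt CQ δW : ℕ → ℝ}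
  {TΛ WA : ℕ → Fin 4 → Site 4 → Fin 4 → Site 4 → MKer 4 (Fin 4)} {CT δT : ℕ → ℝ}
  {ε : ℕ → ℝ} {X : ℕ → Site 4 → MKer 4 (Fin 4)} {Cx δx : ℕ → ℝ}

/-- [folklore] **THE RE-TABLED ROAD BF-x ⟹ THE SPINE's `D1Rep` WITH (J1) AS ONE ROW.**  PART 23's head (`RoadEndBFxHybS.d1Rep_BFx_hyb_sbpS`) with ONE
change: the first-derivative family `S` is PINNED (`hSpin`) to the odd-indexed RAW chart-(III′) member over the COMB table record
`CombTablesAn1.combTablesAn1S2 n h (cΛlit (Nat.log Lc n))` (R-D1-g55-1 (2): the road keeps its comb slice `G₀^{bm}(ctrOff 4 n)` and carries the comb scheme's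
whole table record; at `n = Lc^m` the pin IS `(JsB12CombSh0 (Lc := Lc^m) … (combTablesAn1S2 (Lc^m) hLc.pow (cΛlit m)) … 0).S`, `RoadCombPinAn1.S_at_pow`), its seven
[S] sockets DISCHARGED inside (`RoadCombPinAn1`); the pair family `S₂` and its sockets, the (K)-slot rows, the torus pins, [W], (J2), (C1)–(C3), the GAP ROW and
`hC₁` — the `m`-uniform (1.22) bound of `TshotOf Lc Jc m − hessKer G₀ (vertexOfK G₀ (Lc^m) (S (Lc^m))) (vertex2OfK G₀ (Lc^m) (S₂ (Lc^m)))`, now the RE-TABLED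
chart defect — DISPLAYED VERBATIM in PART 22's shapes.  The literal `Jc`, `Js`, `Nlit ∕ cΛlit ∕ cBlit` are the caller's as before.  Proof = PART 23's, over PART 21♭. -/
theorem d1Rep_BFx_comb_sbpS (Js : ℕ → JetData 3 Lc) (hμν : μ ≠ ν) (hN : N ≠ 0) (hL : 2 ≤ Lc) (hodd : Odd Lc)
    (ha : 0 < a)
    (h12 : B5.Prop12Printed (fam nOf hn1 MOf a ha)) (h126 : B5.Kernel126_127Printed (kfam nOf MOf))
    -- bridge B1 REPLACED: composite jet data, the printed symmetries of the flipped step kernels, the spine's `D1Tel`, the one-shot (K)-estimate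
    (Jc : ∀ m : ℕ, JetData 3 (Lc ^ m))
    (hW : ∀ j, WardTransversal (flipK (TbalOf Lc Js j))) (hRfl : ∀ j, AxisReflectionCovariant (flipK (TbalOf Lc Js j)))
    (htel : D1Tel Lc Js Jc)
    -- ===== THE (K) SLOT AT THE ROAD's OBJECTS (PART 10 `PackedRoadHptwScales.hptw_of_junctions`): per-scale block roots, the literal's stencil
    -- ===== families with their STRUCTURAL SOCKETS, torus sequences, per-bond torus pins, LIFTED [P1′]∕[P2′], and the junctions (J1)(J2)(J3)
    -- the block roots, per scale
    (r : ℕ → Fin 4 → ℕ) (hrpin : ∀ n : ℕ, r n = ctrOff 4 n)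
    -- the literal's first-derivative stencil families, per scale, and their STRUCTURAL SOCKETS
    -- PINNED (R-D1-g43-3 (2)): the odd-indexed RAW member of the (III′) literal, an1's record, locks through `Nat.log Lc`; its [S] sockets are theorems
    (Nlit : ℕ) (cΛlit cBlit : ℕ → ℝ) (S : ℕ → Fin 4 → (Fin 4 → ℤ) → MKer 4 (Fib 3))
    (hSpin : S = (fun n : ℕ => if h : Odd n then (haveI : NeZero n := ⟨h.pos.ne'⟩;
        (JsB12CombSh0 (Lc := n) h Nlit (combTablesAn1S2 n h (cΛlit (Nat.log Lc n))) (cΛlit (Nat.log Lc n)) (cBlit (Nat.log Lc n)) 0).S) else 0))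
    -- the literal's second-derivative stencil families, per scale, and their STRUCTURAL SOCKETS
    (S₂ : ℕ → Fin 4 → (Fin 4 → ℤ) → Fin 4 → (Fin 4 → ℤ) → MKer 4 (Fib 3)) {Ck δ₂ : ℕ → ℝ}
    (hS₂ : ∀ n : ℕ, 2 ≤ n → ∀ κ u κ' u', BiLoc (S₂ n κ u κ' u') u u (Ck n * Real.exp (-δ₂ n * l1 (u' - u))) (δ₂ n))
    (hCk : ∀ n, 0 ≤ Ck n) (hδ₂ : ∀ n, 0 < δ₂ n)
    (hS₂covB : ∀ n : ℕ, 2 ≤ n → ∀ κ' κ'' u u' t, S₂ n κ' (u + ((n : ℕ) : ℤ) • t) κ'' (u' + ((n : ℕ) : ℤ) • t)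
      = shiftK (-(((n : ℕ) : ℤ) • t)) (S₂ n κ' u κ'' u'))
    (hS₂mm : ∀ n : ℕ, 2 ≤ n → ∀ κ u κ' u' x y (c b : Fin 4), S₂ n κ u κ' u' x y (Sum.inr c) (Sum.inr b) = 0)
    (hS₂fm : ∀ n : ℕ, 2 ≤ n → ∀ κ u κ' u' x y (c b : Fin 4),
      S₂ n κ u κ' u' x y (Sum.inl c) (Sum.inr b) = -S₂ n κ u κ' u' y x (Sum.inr b) (Sum.inl c))
    (hS₂ff : ∀ n : ℕ, 2 ≤ n → ∀ κ u κ' u' x y (c b : Fin 4),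
      S₂ n κ u κ' u' x y (Sum.inl c) (Sum.inl b) = S₂ n κ u κ' u' y x (Sum.inl b) (Sum.inl c))
    -- the torus sequences, per scale
    (p : ℕ → ℕ → ℕ) [∀ n k, NeZero (p n k)] (hp : ∀ n, Tendsto (p n) atTop atTop)
    -- the literal's per-bond torus data, per scale, PINNED to the periodised single-bond ∕ pair stencil arrays and THE CONVENTION's generator jets
    (K₁ : ∀ (n : ℕ) [NeZero n] (k : ℕ), I 3 n (p n k) ⊕ J 3 (p n k) → Matrix (I 3 n (p n k)) (I 3 n (p n k)) ℝ)
    (Q₁ : ∀ (n : ℕ) [NeZero n] (k : ℕ), I 3 n (p n k) ⊕ J 3 (p n k) → Matrix (J 3 (p n k)) (I 3 n (p n k)) ℝ)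
    (x₁ : ∀ (n : ℕ) [NeZero n] (k : ℕ), I 3 n (p n k) ⊕ J 3 (p n k) → Matrix (I 3 n (p n k)) (CombRows (toSite (r n)) n (p n k)) ℝ)
    (K₂ : ∀ (n : ℕ) [NeZero n] (k : ℕ), I 3 n (p n k) ⊕ J 3 (p n k) → I 3 n (p n k) ⊕ J 3 (p n k) → Matrix (I 3 n (p n k)) (I 3 n (p n k)) ℝ)
    (Q₂ : ∀ (n : ℕ) [NeZero n] (k : ℕ), I 3 n (p n k) ⊕ J 3 (p n k) → I 3 n (p n k) ⊕ J 3 (p n k) → Matrix (J 3 (p n k)) (I 3 n (p n k)) ℝ)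
    (x₂ : ∀ (n : ℕ) [NeZero n] (k : ℕ), I 3 n (p n k) ⊕ J 3 (p n k) → I 3 n (p n k) ⊕ J 3 (p n k) →
      Matrix (I 3 n (p n k)) (CombRows (toSite (r n)) n (p n k)) ℝ)
    (hK₁ : ∀ n : ℕ, 2 ≤ n → ∀ [NeZero n], ∀ k i, K₁ n k (Sum.inl i) = Matrix.of (periodiseF (p n k) (fTL (sortK n (arr (n * p n k)
      (S n i.2.2 (windowMap 4 (n * p n k) (torusBlockEquiv n (p n k) (i.1, i.2.1)))))))))
    (hQ₁ : ∀ n : ℕ, 2 ≤ n → ∀ [NeZero n], ∀ k i, Q₁ n k (Sum.inl i) = Matrix.of (periodiseF (p n k) (fBL (sortK n (arr (n * p n k)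
      (S n i.2.2 (windowMap 4 (n * p n k) (torusBlockEquiv n (p n k) (i.1, i.2.1)))))))))
    (hx₁ : ∀ n : ℕ, 2 ≤ n → ∀ [NeZero n], ∀ k i, x₁ n k (Sum.inl i) = (Djet (n * p n k) (e₁ n (p n k) i)).submatrix (e₁ n (p n k)) id * Nhat (r n) n (p n k))
    (hK₂ : ∀ n : ℕ, 2 ≤ n → ∀ [NeZero n], ∀ k i j, K₂ n k (Sum.inl i) (Sum.inl j) = Matrix.of (periodiseF (p n k) (fTL (sortK n (fun x y c b => ∑' t : Fin 4 → ℤ,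
      arr (n * p n k) (S₂ n i.2.2 (windowMap 4 (n * p n k) (torusBlockEquiv n (p n k) (i.1, i.2.1))) j.2.2
        (imageShift (n * p n k) (windowMap 4 (n * p n k) (torusBlockEquiv n (p n k) (j.1, j.2.1))) t)) x y c b)))))
    (hQ₂ : ∀ n : ℕ, 2 ≤ n → ∀ [NeZero n], ∀ k i j, Q₂ n k (Sum.inl i) (Sum.inl j) = Matrix.of (periodiseF (p n k) (fBL (sortK n (fun x y c b => ∑' t : Fin 4 → ℤ,
      arr (n * p n k) (S₂ n i.2.2 (windowMap 4 (n * p n k) (torusBlockEquiv n (p n k) (i.1, i.2.1))) j.2.2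
        (imageShift (n * p n k) (windowMap 4 (n * p n k) (torusBlockEquiv n (p n k) (j.1, j.2.1))) t)) x y c b)))))
    (hx₂ : ∀ n : ℕ, 2 ≤ n → ∀ [NeZero n], ∀ k i j, x₂ n k (Sum.inl i) (Sum.inl j) = if i = j then x₁ n k (Sum.inl i) else 0)
    (hK₁0 : ∀ n : ℕ, 2 ≤ n → ∀ [NeZero n], ∀ k j, K₁ n k (Sum.inr j) = 0) (hQ₁0 : ∀ n : ℕ, 2 ≤ n → ∀ [NeZero n], ∀ k j, Q₁ n k (Sum.inr j) = 0)
    (hx₁0 : ∀ n : ℕ, 2 ≤ n → ∀ [NeZero n], ∀ k j, x₁ n k (Sum.inr j) = 0)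
    (hK₂0 : ∀ n : ℕ, 2 ≤ n → ∀ [NeZero n], ∀ k j q, K₂ n k (Sum.inr j) q = 0) (hK₂0' : ∀ n : ℕ, 2 ≤ n → ∀ [NeZero n], ∀ k q j, K₂ n k q (Sum.inr j) = 0)
    (hQ₂0 : ∀ n : ℕ, 2 ≤ n → ∀ [NeZero n], ∀ k j q, Q₂ n k (Sum.inr j) q = 0) (hQ₂0' : ∀ n : ℕ, 2 ≤ n → ∀ [NeZero n], ∀ k q j, Q₂ n k q (Sum.inr j) = 0)
    (hx₂0 : ∀ n : ℕ, 2 ≤ n → ∀ [NeZero n], ∀ k j q, x₂ n k (Sum.inr j) q = 0) (hx₂0' : ∀ n : ℕ, 2 ≤ n → ∀ [NeZero n], ∀ k q j, x₂ n k q (Sum.inr j) = 0)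
    -- the literal's LIFTED table-level Ward identities [P1′]∕[P2′] in the `ad e₃` model (ρ-g16-1′), per torus
    (C : Fin 3 → Matrix (Fin 3) (Fin 3) ℝ) (hC : C 2 = c₃)
    (hP1 : ∀ n : ℕ, 2 ≤ n → ∀ [NeZero n], ∀ k, ∀ q : Fin 3 × (I 3 n (p n k) ⊕ J 3 (p n k)),
      (C q.1 ⊗ₖ kkt (K₁ n k q.2) (Q₁ n k q.2))
          * ((1 : Matrix (Fin 3) (Fin 3) ℝ) ⊗ₖ Matrix.fromRows (What0 (r n) n (p n k)) (0 : Matrix (J 3 (p n k)) (CombRows (toSite (r n)) n (p n k)) ℝ))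
      + ((1 : Matrix (Fin 3) (Fin 3) ℝ) ⊗ₖ kkt (Khat (d := 3) n (p n k)) (Qhat (d := 3) n (p n k)))
          * (C q.1 ⊗ₖ Matrix.fromRows (x₁ n k q.2) (0 : Matrix (J 3 (p n k)) (CombRows (toSite (r n)) n (p n k)) ℝ))
      + oslot (fun q' : Fin 3 × (I 3 n (p n k) ⊕ J 3 (p n k)) =>
            C q'.1 ⊗ₖ Matrix.fromRows (x₁ n k q'.2) (0 : Matrix (J 3 (p n k)) (CombRows (toSite (r n)) n (p n k)) ℝ))
          (fun i => ((1 : Matrix (Fin 3) (Fin 3) ℝ) ⊗ₖ kkt (Khat (d := 3) n (p n k)) (Qhat (d := 3) n (p n k))) i q) = 0)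
    (hP2 : ∀ n : ℕ, 2 ≤ n → ∀ [NeZero n], ∀ k, ∀ q q'' : Fin 3 × (I 3 n (p n k) ⊕ J 3 (p n k)),
      ((C q.1 * C q''.1) ⊗ₖ kkt (K₂ n k q.2 q''.2) (Q₂ n k q.2 q''.2))
          * ((1 : Matrix (Fin 3) (Fin 3) ℝ) ⊗ₖ Matrix.fromRows (What0 (r n) n (p n k)) (0 : Matrix (J 3 (p n k)) (CombRows (toSite (r n)) n (p n k)) ℝ))
      + (C q.1 ⊗ₖ kkt (K₁ n k q.2) (Q₁ n k q.2))
          * (C q''.1 ⊗ₖ Matrix.fromRows (x₁ n k q''.2) (0 : Matrix (J 3 (p n k)) (CombRows (toSite (r n)) n (p n k)) ℝ))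
      + (C q''.1 ⊗ₖ kkt (K₁ n k q''.2) (Q₁ n k q''.2))
          * (C q.1 ⊗ₖ Matrix.fromRows (x₁ n k q.2) (0 : Matrix (J 3 (p n k)) (CombRows (toSite (r n)) n (p n k)) ℝ))
      + ((1 : Matrix (Fin 3) (Fin 3) ℝ) ⊗ₖ kkt (Khat (d := 3) n (p n k)) (Qhat (d := 3) n (p n k)))
          * ((C q.1 * C q''.1) ⊗ₖ Matrix.fromRows (x₂ n k q.2 q''.2) (0 : Matrix (J 3 (p n k)) (CombRows (toSite (r n)) n (p n k)) ℝ))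
      + oslot (fun q' : Fin 3 × (I 3 n (p n k) ⊕ J 3 (p n k)) =>
            C q'.1 ⊗ₖ Matrix.fromRows (x₁ n k q'.2) (0 : Matrix (J 3 (p n k)) (CombRows (toSite (r n)) n (p n k)) ℝ))
          (fun i => (C q''.1 ⊗ₖ kkt (K₁ n k q''.2) (Q₁ n k q''.2)) i q)
      + oslot (fun q' : Fin 3 × (I 3 n (p n k) ⊕ J 3 (p n k)) =>
            (C q''.1 * C q'.1) ⊗ₖ Matrix.fromRows (x₂ n k q''.2 q'.2) (0 : Matrix (J 3 (p n k)) (CombRows (toSite (r n)) n (p n k)) ℝ))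
          (fun i => ((1 : Matrix (Fin 3) (Fin 3) ℝ) ⊗ₖ kkt (Khat (d := 3) n (p n k)) (Qhat (d := 3) n (p n k))) i q)
      + oslot (fun p' : Fin 3 × (I 3 n (p n k) ⊕ J 3 (p n k)) =>
            (C q.1 * C p'.1) ⊗ₖ Matrix.fromRows (x₂ n k q.2 p'.2) (0 : Matrix (J 3 (p n k)) (CombRows (toSite (r n)) n (p n k)) ℝ))
          (fun i => ((1 : Matrix (Fin 3) (Fin 3) ℝ) ⊗ₖ kkt (Khat (d := 3) n (p n k)) (Qhat (d := 3) n (p n k))) i q'') = 0)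
    -- (J1) AS ONE ROW (PART 22; an2 R-D1-g42-1, route (J1-β) priced): NO identity hypothesis — the defect of the spine's one-shot kernel against the road's
    -- kernel `TshotOf Lc Jc m − hessKer (Πᵀ_bm K⁻¹ Π_bm-leg …)` must have `m`-UNIFORMLY BOUNDED (1.22) second moments (the one-loop dressing-independence row, displayed below as `hC₁`)
    -- (J2) the (A2-N) TABLE dictionary AT THE END's LETTERS, per scale, with a rest KERNEL `RJ2 n` (an2's Q-DICT-N; displayed)
    (RJ2 : ℕ → Fin 4 → Fin 4 → Site 4 → ℝ)
    (hJ2 : ∀ n : ℕ, 2 ≤ n → ∀ [NeZero n], ∀ z : Site 4,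
      ((2 : ℝ)⁻¹) ^ 2 * TOfLeg n (Ga n a) (fun κ u => blk (coProjBmAtK (toSite (r n)) n (SN (n - 1) a (S n)) κ u) true true)
            (fun μ' y ν' y' => ((2 : ℝ)⁻¹)⁻¹ • ffW (W2NInf (n - 1) a (r n) (S₂ n)) μ' y ν' y') μ ν z
      = ωgl n * TOfRed n a (SbfBal n a (cE n) (cVH n) (cΛ n) (cR n) (cK n) (cQ n))
          (tableRed n (Wbf (cE₂ n) (cJ4 n) (cΛ₂ n) (cR₂ n) (cQ₂ n) (WE n) (WJ n) (WΛ n) (WR n) (WQ n))) μ ν z + RJ2 n μ ν z)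
    -- (J3): NO HYPOTHESIS — the junction holds with an explicit rest (`GhostDeficitFormula.J3_closed_form`); its rows are displayed below as (C3) + the GAP ROW
    -- ===== THE LANES' INPUTS ON THE SCALES after (C1): the (L1) FLOOR of the literal's first-stencil rate `hδS₀ hδS₀₂` and units inequality `huS`
    -- ===== (the rate `σV` of PART 14 is CHOSEN INSIDE, its (C1) letter `hTs hTm` is leaf-03 g25's `exists_C1_letters`), the (L2) floor ∕ units
    -- ===== `hδ₂₀ hδ₂₀₂ huT`, the co-frame table rate `κc` and the DISPLAYED co-frame table letter (C2) on the scales (`hCs' hCm`); the comb-FP lane AND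
    -- ===== the ghost lane take NO letter; the junction rests' rows below
    {σS δ₂₀ σP : ℝ} {mS : ℝ} {mB mP : Bool → Bool → ℝ}
    (hσS : 0 < σS)
    (hSs : ∀ (k : ℕ), 1 ≤ k → ∀ (κ : Fin 4) (u : Fin 4 → ℤ), Summable fun p : Site 4 × Site 4 =>
      ∑ g, ∑ f, |blk (S (Lc ^ k) κ u) true true p.1 p.2 g f| * Real.exp (σS / ((Lc ^ k : ℕ) : ℝ) * (l1 (p.1 - u) + l1 (p.2 - u))))
    (hSm : ∀ (k : ℕ), 1 ≤ k → ∀ (κ : Fin 4) (u : Fin 4 → ℤ), ∑' p : Site 4 × Site 4,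
      ∑ g, ∑ f, |blk (S (Lc ^ k) κ u) true true p.1 p.2 g f| * Real.exp (σS / ((Lc ^ k : ℕ) : ℝ) * (l1 (p.1 - u) + l1 (p.2 - u))) ≤ mS)
    (hσP : 0 < σP)
    (hPs : ∀ (k : ℕ), 1 ≤ k → ∀ (ρ : Fin 4) (y : Site 4) (j k' : Bool), j ≠ k' → Summable fun p : Site 4 × Site 4 => ∑ g, ∑ f,
      |blk (vertexOfK (coDressKBmAt (toSite (r (Lc ^ k))) (Lc ^ k) (KInvStep (d := 3) (Lc ^ k) 0)) (Lc ^ k) (S (Lc ^ k)) ρ y) j k' p.1 p.2 g f|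
        * Real.exp (σP / ((Lc ^ k : ℕ) : ℝ) * (l1 (p.1 - ((Lc ^ k : ℕ) : ℤ) • y) + l1 (p.2 - ((Lc ^ k : ℕ) : ℤ) • y))))
    (hPm : ∀ (k : ℕ), 1 ≤ k → ∀ (ρ : Fin 4) (y : Site 4) (j k' : Bool), j ≠ k' → ∑' p : Site 4 × Site 4, ∑ g, ∑ f,
      |blk (vertexOfK (coDressKBmAt (toSite (r (Lc ^ k))) (Lc ^ k) (KInvStep (d := 3) (Lc ^ k) 0)) (Lc ^ k) (S (Lc ^ k)) ρ y) j k' p.1 p.2 g f|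
        * Real.exp (σP / ((Lc ^ k : ℕ) : ℝ) * (l1 (p.1 - ((Lc ^ k : ℕ) : ℤ) • y) + l1 (p.2 - ((Lc ^ k : ℕ) : ℤ) • y))) ≤ mP j k')
    (hδ₂₀ : 0 < δ₂₀)
    (hBs : ∀ (k : ℕ), 1 ≤ k → ∀ (κ : Fin 4) (u : Fin 4 → ℤ) (κ' : Fin 4) (u' : Fin 4 → ℤ) (j i : Bool),
      Summable fun p : Site 4 × Site 4 => ∑ g, ∑ f, |blk (S₂ (Lc ^ k) κ u κ' u') j i p.1 p.2 g f|)
    (hBm : ∀ (k : ℕ), 1 ≤ k → ∀ (κ : Fin 4) (u : Fin 4 → ℤ) (κ' : Fin 4) (u' : Fin 4 → ℤ) (j i : Bool),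
      ∑' p : Site 4 × Site 4, ∑ g, ∑ f, |blk (S₂ (Lc ^ k) κ u κ' u') j i p.1 p.2 g f|
        ≤ mB j i * Real.exp (-(δ₂₀ / ((Lc ^ k : ℕ) : ℝ)) * l1 (u' - u)))
    -- (C2): NO HYPOTHESIS — leaf-03 g25's `CoframeTableMassScales.exists_C2_letters` (gan24-leaf-05 g54's δ4b) supplies `κc mC hκc hCs' hCm` inside
    {CJ2 : ℝ}
    (hMR₂ : ∀ m : ℕ, 1 ≤ m → AbsMoment₂ (RJ2 (Lc ^ m) μ ν)) (hC₂ : ∀ m : ℕ, 1 ≤ m → |B12Beta.secondMoment (RJ2 (Lc ^ m)) μ ν| ≤ CJ2)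
    -- (J1)'s ONE ROW: the `m`-uniform (1.22) bound of the DEFECT (its absolute summability is a theorem: `absMoment₂_TshotOf` + PART 20a)
    {CJ1 : ℝ}
    (hC₁ : ∀ m : ℕ, 1 ≤ m → |B12Beta.secondMoment (fun (c e : Fin 4) (z : Site 4) => TshotOf Lc Jc m c e z -
        hessKer (coDressKBmAt (toSite (r (Lc ^ m))) (Lc ^ m) (KInvStep (d := 3) (Lc ^ m) 0))
        (vertexOfK (coDressKBmAt (toSite (r (Lc ^ m))) (Lc ^ m) (KInvStep (d := 3) (Lc ^ m) 0)) (Lc ^ m) (S (Lc ^ m)))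
        (vertex2OfK (coDressKBmAt (toSite (r (Lc ^ m))) (Lc ^ m) (KInvStep (d := 3) (Lc ^ m) 0)) (Lc ^ m) (S₂ (Lc ^ m))) c e z) μ ν| ≤ CJ1)
    -- (C3): NO HYPOTHESIS — gan24-leaf-05 g55's `GhostQWordsScales.exists_C3_rows` (ε3) supplies the four `Q′`-words' rows `CB hMRB hCB` inside (as PART 19)
    {Cgap : ℝ}
    -- THE GHOST NORMALISATION GAP ROW (F-g20-1): the END's expected ghost main term minus the road's, `(4N²n⁸ − 2)·PghQ(unit ray)`, must have
    -- `m`-uniformly bounded (1.22) second moment — `= (4N² − 2n⁻⁸)·(the uniform base-point average of the punctured full sums of the unit-ray fine ghost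
    -- Hessian)` by `AssemblySlots.hF_PghQ_ray`; displayed, NOT asserted
    (hGap : ∀ m : ℕ, 1 ≤ m → |(4 * N ^ 2 * ((Lc ^ m : ℕ) : ℝ) ^ 8 - 2)
        * B12Beta.secondMoment (fun (c e : Fin 4) (z : Site 4) => PghQ (Lc ^ m) a (-1) (((Lc ^ m : ℕ) : ℝ) ^ 2) a c e z) μ ν| ≤ Cgap)
    -- the RESCALED loop-weight tie of reading (ii): displayed scalar family `s`, pinned `s n = n⁻²`; the normalisation
    (s : ℕ → ℝ) (hs : ∀ n : ℕ, 2 ≤ n → s n = ((n : ℝ) ^ 2)⁻¹) (hωs : ∀ n : ℕ, 2 ≤ n → ωgh n * (s n * cK n) ^ 2 = -2 * (ωgl n * cE n ^ 2))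
    (hlam : ∀ n : ℕ, 2 ≤ n → ωgl n * cE n ^ 2 = 2 * N ^ 2 * (n : ℝ) ^ 8)
    -- pins and the ray (the rows' letters)
    (hcE : ∀ n : ℕ, 2 ≤ n → cE n = (n : ℝ) ^ 4) (hRsgn : ∀ n : ℕ, 2 ≤ n → cR n = -cE n) (hJ4 : ∀ n : ℕ, cJ4 n = 0)
    (hcgh : ∀ n : ℕ, |cgh n| ≤ cgh₀) (hKray : ∀ n : ℕ, cK n = cgh n * (n : ℝ) ^ 2) (hQray : ∀ n : ℕ, cQ n = cgh n * a) (hx : ∀ n : ℕ, x₀ n = -cgh n)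
    -- slot-table sockets (the END's), covariance, bond swap; `hdiv` (the ghost Ward rows `hrowgh` are a THEOREM on the ray: discharged inside)
    (hδW : ∀ n, 0 < δW n)
    (hE : ∀ n κ u l u', BiLoc (WE n κ u l u') u u' (CE n) (δW n)) (hJ : ∀ n κ u l u', BiLoc (WJ n κ u l u') u u' (CJ n) (δW n))
    (hΛ : ∀ n κ u l u', BiLoc (WΛ n κ u l u') u u' (CΛt n) (δW n)) (hR : ∀ n κ u l u', BiLoc (WR n κ u l u') u u' (CRt n) (δW n))
    (hQ : ∀ n κ u l u', BiLoc (WQ n κ u l u') u u' (CQ n) (δW n))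
    (hEc : ∀ (n : ℕ) (κ : Fin 4) (u : Site 4) (l : Fin 4) (u' t : Site 4),
      WE n κ (u + (n : ℤ) • t) l (u' + (n : ℤ) • t) = shiftK (-((n : ℤ) • t)) (WE n κ u l u'))
    (hJc : ∀ (n : ℕ) (κ : Fin 4) (u : Site 4) (l : Fin 4) (u' t : Site 4),
      WJ n κ (u + (n : ℤ) • t) l (u' + (n : ℤ) • t) = shiftK (-((n : ℤ) • t)) (WJ n κ u l u'))
    (hΛc : ∀ (n : ℕ) (κ : Fin 4) (u : Site 4) (l : Fin 4) (u' t : Site 4),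
      WΛ n κ (u + (n : ℤ) • t) l (u' + (n : ℤ) • t) = shiftK (-((n : ℤ) • t)) (WΛ n κ u l u'))
    (hRc : ∀ (n : ℕ) (κ : Fin 4) (u : Site 4) (l : Fin 4) (u' t : Site 4),
      WR n κ (u + (n : ℤ) • t) l (u' + (n : ℤ) • t) = shiftK (-((n : ℤ) • t)) (WR n κ u l u'))
    (hQc : ∀ (n : ℕ) (κ : Fin 4) (u : Site 4) (l : Fin 4) (u' t : Site 4),
      WQ n κ (u + (n : ℤ) • t) l (u' + (n : ℤ) • t) = shiftK (-((n : ℤ) • t)) (WQ n κ u l u'))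
    (hEs : ∀ n κ u l u', WE n κ u l u' = WE n l u' κ u) (hJs : ∀ n κ u l u', WJ n κ u l u' = WJ n l u' κ u)
    (hΛs : ∀ n κ u l u', WΛ n κ u l u' = WΛ n l u' κ u) (hRs : ∀ n κ u l u', WR n κ u l u' = WR n l u' κ u)
    (hQs : ∀ n κ u l u', WQ n κ u l u' = WQ n l u' κ u)
    (hdiv : ∀ n : ℕ, 2 ≤ n → ∀ [NeZero n], ∀ (l' : Fin 4) (u' u : Site 4), ∑ κ' : Fin 4,
      (fineHess n a (SbfBal n a (cE n) (cVH n) (cΛ n) (cR n) (cK n) (cQ n))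
          (Wbf (cE₂ n) (cJ4 n) (cΛ₂ n) (cR₂ n) (cQ₂ n) (WE n) (WJ n) (WΛ n) (WR n) (WQ n)) κ' l' (u - Pi.single κ' 1) u'
        - fineHess n a (SbfBal n a (cE n) (cVH n) (cΛ n) (cR n) (cK n) (cQ n))
          (Wbf (cE₂ n) (cJ4 n) (cΛ₂ n) (cR₂ n) (cQ₂ n) (WE n) (WJ n) (WΛ n) (WR n) (WQ n)) κ' l' u u') = 0)
    -- (LOCAL) slot-E support and units; slot-R envelope and units (the three local ghost bubbles are SUPPLIED under reading (ii))
    {ρE : ℕ} {δ₀ kE : ℝ} (hδ₀ : 0 < δ₀) (hδE : ∀ n, δ₀ ≤ δW n)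
    (hsuppE : ∀ n κ u l u', ρE < supNorm (u - u') → WE n κ u l u' = 0)
    (hkE : ∀ n : ℕ, 2 ≤ n → |ωgl n * cE₂ n| * CE n ≤ kE * (n : ℝ) ^ 8)
    {CwR δR : ℕ → ℝ} {θR δ₀R kR : ℝ} (hθR : 0 < θR) (hδR : ∀ n, 0 < δR n) (hδ₀R : 0 < δ₀R) (hδRge : ∀ n : ℕ, δ₀R / n ≤ δR n) (hCwR : ∀ n, 0 ≤ CwR n)
    (hWRenv : ∀ n κ u l u', BiLoc (WR n κ u l u') u u' (CwR n * Real.exp (-(θR / n) * supNorm (u - u'))) (δR n))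
    (hkR : ∀ n : ℕ, 2 ≤ n → |ωgl n * cR₂ n| * CwR n * (n : ℝ) ^ 6 ≤ kR)
    -- (Λ) sockets and zero-momentum data
    (hδT : ∀ n, 0 < δT n)
    (hdec : ∀ n : ℕ, 2 ≤ n → ∀ [NeZero n], ∀ κ u l u', WΛ n κ u l u' =
      (∑ m : Fin 4, OneStepResolventKernel.wsum (onLat n (fun y => lamCoeffOf (KInv (N := n) (d := 3)) n m y l u'))
          (fun v => onLat n (fun y => TΛ n m y κ u) v))
      + (∑ m : Fin 4, OneStepResolventKernel.wsum (onLat n (fun y => lamCoeffOf (KInv (N := n) (d := 3)) n m y κ u))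
          (fun v => onLat n (fun y => TΛ n m y l u') v))
      + WA n κ u l u')
    (hTloc : ∀ (n : ℕ) m y κ u, BiLoc (TΛ n m y κ u) ((n : ℤ) • y) ((n : ℤ) • y) (CT n * Real.exp (-δT n * l1 ((n : ℤ) • y - u))) (δT n))
    (hWAa : ∀ n κ u l u', trK (WA n κ u l u') = -WA n κ u l u') (hWAl : ∀ n κ u l u', Loc (WA n κ u l u'))
    (hTcov : ∀ (n : ℕ) m y κ u t, TΛ n m (y + t) κ (u + (n : ℤ) • t) = shiftK (-((n : ℤ) • t)) (TΛ n m y κ u))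
    (hcΛ : ∀ n : ℕ, 2 ≤ n → cΛ n ≠ 0) (hε : ∀ n : ℕ, ε n = 1 ∨ ε n = -1) (hδx : ∀ n, 0 < δx n) (hX : ∀ n u, BiLoc (X n u) u u (Cx n) (δx n))
    (hW1 : ∀ n : ℕ, 2 ≤ n → ∀ [NeZero n], ∀ u,
      comp (comp (Ga n a) (divV (fun κ v => ε n • SbfBal n a (cE n) (cVH n) (cΛ n) (cR n) (cK n) (cQ n) κ v) u)) (Ga n a) =
        comp (Ga n a) (X n u) - comp (X n u) (Ga n a))
    (hW2 : ∀ n : ℕ, 2 ≤ n → ∀ [NeZero n], ∀ (m : Fin 4) (u : Site 4),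
      divV (fun κ v => (-(ε n * (cΛ₂ n / cΛ n))) • TΛ n m 0 κ v) u = comp (X n u) (ffOf (hessFF n m 0)) - comp (ffOf (hessFF n m 0)) (X n u))
    -- (N) slot Q's SOCKETS (the (A2) readout of `WQ`: a decaying bi-localisation envelope at a BLOCK-scale rate floor and its units line — T₈ ⟸ `NeedleTadpoleRowDecay`)
    {CwQ δQ : ℕ → ℝ} {θQ δ₀Q kQ : ℝ} (hθQ : 0 < θQ) (hδQ : ∀ n, 0 < δQ n) (hδ₀Q : 0 < δ₀Q) (hδQge : ∀ n : ℕ, δ₀Q / n ≤ δQ n) (hCwQ : ∀ n, 0 ≤ CwQ n)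
    (hWQenv : ∀ n κ u l u', BiLoc (WQ n κ u l u') u u' (CwQ n * Real.exp (-(θQ / n) * supNorm (u - u'))) (δQ n))
    (hkQ : ∀ n : ℕ, 2 ≤ n → |ωgl n * cQ₂ n| * CwQ n * (n : ℝ) ^ 6 ≤ kQ)
    -- base-point labels of the free one-shot side (the spine root's `hSL` ∕ `k`); the Literature's window data is discharged at `M := id`, `cc := 1`
    {L : Type*} {SL : Finset L} (hSL : SL.Nonempty) (k : L → Fin 4) :
    D1Rep Lc Jc N μ ν a SL k := by
  have hL1 : 1 < Lc := hL
  -- the root pin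
  have hr : ∀ m : ℕ, r (m + 1) ∈ box (3 + 1) (m + 1) := fun m => by rw [hrpin]; exact ctrOff_mem_box (by omega)
  -- the seven [S] sockets of the pinned family (`RoadHybPinAn1`)
  have hS : ∀ n : ℕ, 2 ≤ n → LocStencil (S n) ((fun n : ℕ => if h : Odd n then (haveI : NeZero n := ⟨h.pos.ne'⟩;
        (JsB12CombSh0 (Lc := n) h Nlit (combTablesAn1S2 n h (cΛlit (Nat.log Lc n))) (cΛlit (Nat.log Lc n)) (cBlit (Nat.log Lc n)) 0).Cs) else 0) n)
      ((fun n : ℕ => if h : Odd n then (haveI : NeZero n := ⟨h.pos.ne'⟩;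
        (JsB12CombSh0 (Lc := n) h Nlit (combTablesAn1S2 n h (cΛlit (Nat.log Lc n))) (cΛlit (Nat.log Lc n)) (cBlit (Nat.log Lc n)) 0).δ) else 1) n) := fun n _ => by
    rw [hSpin]; exact RoadCombPinAn1.S_locStencil Lc Nlit cΛlit cBlit n
  have hCs : ∀ n : ℕ, 0 ≤ (fun n : ℕ => if h : Odd n then (haveI : NeZero n := ⟨h.pos.ne'⟩;
        (JsB12CombSh0 (Lc := n) h Nlit (combTablesAn1S2 n h (cΛlit (Nat.log Lc n))) (cΛlit (Nat.log Lc n)) (cBlit (Nat.log Lc n)) 0).Cs) else 0) n :=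
    RoadCombPinAn1.Cs_nonneg Lc Nlit cΛlit cBlit
  have hδS : ∀ n : ℕ, 0 < (fun n : ℕ => if h : Odd n then (haveI : NeZero n := ⟨h.pos.ne'⟩;
        (JsB12CombSh0 (Lc := n) h Nlit (combTablesAn1S2 n h (cΛlit (Nat.log Lc n))) (cΛlit (Nat.log Lc n)) (cBlit (Nat.log Lc n)) 0).δ) else 1) n :=
    RoadCombPinAn1.δ_pos Lc Nlit cΛlit cBlit
  have hScovB : ∀ n : ℕ, 2 ≤ n → ∀ (κ' : Fin 4) (u t : Fin 4 → ℤ), S n κ' (u + ((n : ℕ) : ℤ) • t) = shiftK (-(((n : ℕ) : ℤ) • t)) (S n κ' u) :=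
    fun n _ κ' u t => by rw [hSpin]; exact RoadCombPinAn1.S_covB Lc Nlit cΛlit cBlit n κ' u t
  have hSmm : ∀ n : ℕ, 2 ≤ n → ∀ (κ' : Fin 4) (u x y : Fin 4 → ℤ) (c b : Fin 4), S n κ' u x y (Sum.inr c) (Sum.inr b) = 0 :=
    fun n _ κ' u x y c b => by rw [hSpin]; exact RoadCombPinAn1.S_inr_inr Lc Nlit cΛlit cBlit n κ' u x y c b
  have hSfm : ∀ n : ℕ, 2 ≤ n → ∀ (κ' : Fin 4) (u x y : Fin 4 → ℤ) (c b : Fin 4),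
      S n κ' u x y (Sum.inl c) (Sum.inr b) = S n κ' u y x (Sum.inr b) (Sum.inl c) :=
    fun n _ κ' u x y c b => by rw [hSpin]; exact RoadCombPinAn1.S_inl_inr Lc Nlit cΛlit cBlit n κ' u x y c b
  have hSff : ∀ n : ℕ, 2 ≤ n → ∀ (κ' : Fin 4) (u x y : Fin 4 → ℤ) (c b : Fin 4),
      S n κ' u x y (Sum.inl c) (Sum.inl b) = -S n κ' u y x (Sum.inl b) (Sum.inl c) :=
    fun n _ κ' u x y c b => by rw [hSpin]; exact RoadCombPinAn1.S_inl_inl Lc Nlit cΛlit cBlit n κ' u x y c b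
  have hr2 : ∀ n : ℕ, 2 ≤ n → ∀ [NeZero n], r n ∈ box (3 + 1) n := fun n hn _ => by
    obtain ⟨m, rfl⟩ : ∃ m, n = m + 1 := ⟨n - 1, by omega⟩
    exact hr m
  -- the DEFECT as a kernel family indexed by the scale `n` (read at `n = Lc^m` through `Nat.log Lc (Lc^m) = m`; zero below scale 2)
  set RJ1 : ℕ → Fin 4 → Fin 4 → Site 4 → ℝ := fun n c e z => if hn : 2 ≤ n then (haveI : NeZero n := ⟨by omega⟩;
      TshotOf Lc Jc (Nat.log Lc n) c e z -
        hessKer (coDressKBmAt (toSite (r n)) n (KInvStep (d := 3) n 0))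
        (vertexOfK (coDressKBmAt (toSite (r n)) n (KInvStep (d := 3) n 0)) n (S n))
        (vertex2OfK (coDressKBmAt (toSite (r n)) n (KInvStep (d := 3) n 0)) n (S₂ n)) c e z) else 0 with hRJ1
  have h2 : ∀ m : ℕ, 1 ≤ m → 2 ≤ Lc ^ m := fun m hm => two_le_pow_scale hL hm
  have hRJ1m : ∀ m : ℕ, 1 ≤ m → RJ1 (Lc ^ m) = fun c e z => TshotOf Lc Jc m c e z -
        hessKer (coDressKBmAt (toSite (r (Lc ^ m))) (Lc ^ m) (KInvStep (d := 3) (Lc ^ m) 0))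
        (vertexOfK (coDressKBmAt (toSite (r (Lc ^ m))) (Lc ^ m) (KInvStep (d := 3) (Lc ^ m) 0)) (Lc ^ m) (S (Lc ^ m)))
        (vertex2OfK (coDressKBmAt (toSite (r (Lc ^ m))) (Lc ^ m) (KInvStep (d := 3) (Lc ^ m) 0)) (Lc ^ m) (S₂ (Lc ^ m))) c e z := fun m hm => by
    funext c e z
    rw [hRJ1]
    simp only [dif_pos (h2 m hm), Nat.log_pow hL1]
  have hMR1 : ∀ m : ℕ, 1 ≤ m → AbsMoment₂ (RJ1 (Lc ^ m) μ ν) := fun m hm => by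
    rw [hRJ1m m hm]
    exact absMoment₂_sub_gen (absMoment₂_TshotOf Jc m μ ν) (absMoment₂_road_kernel hL hr2 hS hCs hδS hS₂ hCk hδ₂ Jc m hm μ ν)
  have hC1 : ∀ m : ℕ, 1 ≤ m → |B12Beta.secondMoment (RJ1 (Lc ^ m)) μ ν| ≤ CJ1 := fun m hm => by
    rw [hRJ1m m hm]
    exact hC₁ m hm
  have hJ1 : ∀ m : ℕ, 1 ≤ m → ∀ z : Site 4, TshotOf Lc Jc m μ ν z =
        hessKer (coDressKBmAt (toSite (r (Lc ^ m))) (Lc ^ m) (KInvStep (d := 3) (Lc ^ m) 0))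
        (vertexOfK (coDressKBmAt (toSite (r (Lc ^ m))) (Lc ^ m) (KInvStep (d := 3) (Lc ^ m) 0)) (Lc ^ m) (S (Lc ^ m)))
        (vertex2OfK (coDressKBmAt (toSite (r (Lc ^ m))) (Lc ^ m) (KInvStep (d := 3) (Lc ^ m) 0)) (Lc ^ m) (S₂ (Lc ^ m))) μ ν z + RJ1 (Lc ^ m) μ ν z := fun m hm z => by
    rw [hRJ1m m hm]
    beta_reduce
    ring
  exact d1Rep_BFx_road_scales_J1rest_flat_sbpS Js hμν hN hL hodd ha h12 h126 Jc hW hRfl htel r hr S hS hCs hδS hScovB hSmm hSfm hSff S₂ hS₂ hCk hδ₂ hS₂covB hS₂mm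
    hS₂fm hS₂ff p hp K₁ Q₁ x₁ K₂ Q₂ x₂ hK₁ hQ₁ hx₁ hK₂ hQ₂ hx₂ hK₁0 hQ₁0 hx₁0 hK₂0 hK₂0' hQ₂0 hQ₂0' hx₂0 hx₂0' C hC hP1 hP2 RJ1 hJ1 RJ2 hJ2 hσS hSs hSm hσP hPs hPm hδ₂₀
    hBs hBm hMR₂ hC₂ hMR1 hC1 hGap s hs hωs hlam hcE hRsgn hJ4 hcgh hKray hQray hx hδW hE hJ hΛ hR hQ hEc hJc hΛc hRc hQc hEs hJs hΛs hRs hQs hdiv hδ₀ hδE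
    hsuppE hkE hθR hδR hδ₀R hδRge hCwR hWRenv hkR hδT hdec hTloc hWAa hWAl hTcov hcΛ hε hδx hX hW1 hW2 hθQ hδQ hδ₀Q hδQge hCwQ hWQenv hkQ hSL k

end Summit.QuantumFields.BalabanUV.Beta.D1BFx.RoadEndBFxCombS

end
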